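import Mathlib.Data.Real.Basic
import Mathlib.Data.Matrix.Mul
import Mathlib.LinearAlgebra.Matrix.Symmetric
import Mathlib.Algebra.BigOperators.Ring.Finset
import HarnessLib

/-!
# The matrix of a weighted sum of squares of linear functionals

A quadratic expression `Q(φ) = Σ_{k ∈ s} c_k (u_k · φ)²` in a real field `φ : Λ → ℝ` (finite `Λ`) — e.g. a
Gaussian action assembled from squares of local linear functionals (window / path sums of gradients) —
is the quadratic form of the explicit symmetric matrix `H = Σ_k c_k u_k u_kᵀ`:

* `Literature.LinearAlgebra.Matrix.sosMatrix s c u = Σ_{k ∈ s} c_k • vecMulVec u_k u_k`;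
* `dotProduct_sosMatrix_mulVec : φ ⬝ᵥ H *ᵥ φ = Σ_k c_k (u_k ⬝ᵥ φ)²` and the polar form
  `dotProduct_sosMatrix_mulVec' : φ ⬝ᵥ H *ᵥ ψ = Σ_k c_k (u_k ⬝ᵥ φ)(u_k ⬝ᵥ ψ)`;
* `isSymm_sosMatrix`;
* `sosMatrix_mulVec_const : (∀ k, Σ_x u_k x = 0) → H *ᵥ 1 = 0` — functionals killing the constants
  (functionals of the GRADIENT field) give a shift-invariant form.

Everything is proved; no named fact is introduced. [folklore]
-/

namespace Literature.LinearAlgebra.Matrix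

open scoped BigOperators
open _root_.Matrix

variable {Λ : Type*} {κ : Type*}

/-- The matrix `Σ_{k ∈ s} c_k u_k u_kᵀ` of the weighted sum of squares `Σ_k c_k (u_k · φ)²`. [folklore] -/
def sosMatrix (s : Finset κ) (c : κ → ℝ) (u : κ → Λ → ℝ) : Matrix Λ Λ ℝ :=
  ∑ k ∈ s, c k • vecMulVec (u k) (u k)

/-- Entries of `sosMatrix`. [folklore] -/
theorem sosMatrix_apply (s : Finset κ) (c : κ → ℝ) (u : κ → Λ → ℝ) (x y : Λ) :
    sosMatrix s c u x y = ∑ k ∈ s, c k * (u k x * u k y) := by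
  simp [sosMatrix, Matrix.sum_apply, vecMulVec_apply]

/-- `sosMatrix` is symmetric. [folklore] -/
theorem isSymm_sosMatrix (s : Finset κ) (c : κ → ℝ) (u : κ → Λ → ℝ) : (sosMatrix s c u).IsSymm := by
  ext x y
  simp only [transpose_apply, sosMatrix_apply]
  exact Finset.sum_congr rfl fun k _ => by ring

variable [Fintype Λ]

/-- The action of `sosMatrix` on a vector: `H ψ = Σ_k c_k (u_k · ψ) u_k`. [folklore] -/
theorem sosMatrix_mulVec (s : Finset κ) (c : κ → ℝ) (u : κ → Λ → ℝ) (ψ : Λ → ℝ) :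
    sosMatrix s c u *ᵥ ψ = ∑ k ∈ s, (c k * (u k ⬝ᵥ ψ)) • u k := by
  funext x
  simp only [Matrix.mulVec, dotProduct, sosMatrix_apply, Finset.sum_apply, Pi.smul_apply, smul_eq_mul,
    Finset.mul_sum, Finset.sum_mul]
  rw [Finset.sum_comm]
  exact Finset.sum_congr rfl fun k _ => Finset.sum_congr rfl fun y _ => by ring

/-- **Polar form**: `φ ⬝ᵥ H *ᵥ ψ = Σ_k c_k (u_k ⬝ᵥ φ)(u_k ⬝ᵥ ψ)`. [folklore] -/
theorem dotProduct_sosMatrix_mulVec' (s : Finset κ) (c : κ → ℝ) (u : κ → Λ → ℝ) (φ ψ : Λ → ℝ) :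
    φ ⬝ᵥ sosMatrix s c u *ᵥ ψ = ∑ k ∈ s, c k * ((u k ⬝ᵥ φ) * (u k ⬝ᵥ ψ)) := by
  rw [sosMatrix_mulVec, dotProduct_sum]
  refine Finset.sum_congr rfl fun k _ => ?_
  rw [dotProduct_smul, smul_eq_mul, dotProduct_comm φ (u k)]
  ring

/-- **The weighted sum of squares is the quadratic form of `sosMatrix`**:
`φ ⬝ᵥ H *ᵥ φ = Σ_k c_k (u_k ⬝ᵥ φ)²`. [folklore] -/
theorem dotProduct_sosMatrix_mulVec (s : Finset κ) (c : κ → ℝ) (u : κ → Λ → ℝ) (φ : Λ → ℝ) :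
    φ ⬝ᵥ sosMatrix s c u *ᵥ φ = ∑ k ∈ s, c k * (u k ⬝ᵥ φ) ^ 2 := by
  rw [dotProduct_sosMatrix_mulVec']
  exact Finset.sum_congr rfl fun k _ => by ring

/-- **Functionals killing the constants give a shift-invariant form**: if every `u_k` has coordinate sum `0`
then `H *ᵥ 1 = 0`. [folklore] -/
theorem sosMatrix_mulVec_const (s : Finset κ) (c : κ → ℝ) (u : κ → Λ → ℝ) (h : ∀ k ∈ s, ∑ x, u k x = 0) :
    sosMatrix s c u *ᵥ (fun _ => (1 : ℝ)) = 0 := by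
  rw [sosMatrix_mulVec]
  refine Finset.sum_eq_zero fun k hk => ?_
  have : u k ⬝ᵥ (fun _ => (1 : ℝ)) = 0 := by simp [dotProduct, h k hk]
  rw [this, mul_zero, zero_smul]

end Literature.LinearAlgebra.Matrix
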